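import Mathlib
import Summits.ValiantsHypothesis.ValiantsHypothesis.Theses.LiouvilleSarnak
import Summits.ValiantsHypothesis.ValiantsHypothesis.Theorems.LiouvilleSarnakDigitalBilinearLiouvilleTtStarTransfer

/-!
# Route LiouvilleSarnak — crux `DigitalBilinearLiouville` (stmt-ValiantsHypothesis-14774), line
# `tt_star`: the VAN DER CORPUT / SHORT-DIGITAL-SHIFT step for the open stub `stub_twoPointDigital`

The open stub of line `Cruxes/DigitalBilinearLiouville/Lines/tt_star.lean` (crux-equivalent, see
`…TtStarTransfer.lean`) asks, for every balanced cut `π` of the `2n` bit positions,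
`S(π) := Σ_{r,r'} ‖Σ_c λ(m_{rc}) λ(m_{r'c})‖² ≤ ε 16^n` (`m_{rc} = N_π(r,c) + 1`), i.e. the Frobenius norm of
the Gram matrix of the `2^n × 2^n` sign matrix `M_π` is `o(4^n)`.  By the four-fold symmetry
`S(π) = Σ_{c,c'} (Σ_r λ(m_{rc}) λ(m_{rc'}))²` the same number is the Gram sum of the COLUMNS, a sum over
ALL pairs of columns `(c, c')`, i.e. over all COLUMN SHIFTS `d_C = N_π(r,c') - N_π(r,c)` up to the range.

This file proves the differencing step that removes the long shifts (the digital analogue of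
van der Corput's `|Σ_n f(n)|² ≤ (N/H) Σ_{|h|<H} Σ_n f(n+h) conj f(n)`):

* §1 (pure algebra, any real matrix) `gramSum_symm` — `Σ_{c,c'} (Σ_r a_{rc} a_{rc'})² =
  Σ_{r,r'} (Σ_c a_{rc} a_{r'c})²`; ★ `gramSum_le_card_mul_fibreSum` — if the columns are indexed by
  `α × β` then `Σ_{p,q} (Σ_r a_{rp} a_{rq})² ≤ |β| · Σ_b Σ_{i,j ∈ α} (Σ_r a_{r(i,b)} a_{r(j,b)})²`:
  the full Gram sum is at most (number of fibres) × (Gram sum over pairs of columns IN THE SAME FIBRE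
  `{(·, b)}`).  Proof: symmetric form, Cauchy–Schwarz over the fibres, symmetric form again.
* §2 (the cut matrices, level `n = k + m`, columns `c = Fin.append i t` with LOW column bits
  `i : Fin k → Bool` and HIGH column bits `t : Fin m → Bool`) ★ `twoPoint_le_shortShifts` —
  `S(π) ≤ 2^m · Σ_t Σ_{i,j} (Σ_r λ(m_{r,(i,t)}) λ(m_{r,(j,t)}))²`, and ★ `twoPoint_le_diag_add_shortShifts` —
  `S(π) ≤ 16^n / 2^k + 2^m · Σ_t Σ_{i ≠ j} (Σ_r λ(m_{r,(i,t)}) λ(m_{r,(j,t)}))²`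
  (the pairs `i = j` contribute exactly `16^n / 2^k`).  Only pairs of columns that differ in their
  `k` LOWEST column bits survive: for the monotone labelling of a cut these are the SHORT digital
  column shifts (supported on the `k` lowest column positions), in mean square over the other column
  bits `t`, summed along the full row family `r`.
* §3 ★ `twoPointDigital_of_shortShifts` / ★ `digitalBilinearLiouville_of_shortShifts` — hence the
  stub, and (by the landed `…TtStar.digitalBilinearLiouville_of_twoPointDigital`) the crux
  `DigitalBilinearLiouville` BY NAME, follow from the family of FIXED-SHORT-SHIFT statements
  `SDS(k)`: for every `k`, every pair of low patterns `i ≠ j` and all large `m`, uniformly in `π`,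
  `Σ_t (Σ_r λ(m_{r,(i,t)}) λ(m_{r,(j,t)}))² ≤ ε 8^{k+m}` (trivial bound `8^{k+m}/2^k`).
  For the ALIGNED cut (`c` = the `n` low bits, `r` = the `n` high bits) `SDS(k)` reads: for each fixed
  residue pair `i ≠ j (mod 2^k)`, `Σ_{t < 2^m} (Σ_{b < 2^n} λ(2^n b + 2^k t + i + 1) λ(2^n b + 2^k t + j + 1))²
  = o(8^n)` — two-point correlations of `λ` with a FIXED small shift along the progressions of modulus
  `2^n = √X`, in mean square over the residues: the two-point analogue of the PROVED rung `AlignedTypeI`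
  (stmt-21040, one-point, `ℓ¹` over residues).

Honest framing.  A reduction, not a case of the crux: `SDS(k)` is OPEN (already its aligned `k = 1`
instance gives, by Cauchy–Schwarz over `t`, two-point Chowla `Σ_{m ≤ 4^n, m odd} λ(m) λ(m+1) = o(4^n)`
at the scales `X = 4^n`, which is not known — Tao / Helfgott–Radziwiłł are logarithmic, Tao–Teräväinen
is almost-all-scales), and `SDS` is NOT implied by the crux (the short-shift band is invisible at the
scale `ε 16^n`), so it is a sufficient condition in van der Corput currency, strictly between nothing
and the crux in the books.  `DigitalBilinearLiouville`, `LiouvilleCutRank`, `AlgebraicSarnak` stay OPEN;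
nothing here bears on VP versus VNP.  No definitions (columns are written `Fin.append i t`).
-/

-- the directory `ValiantsHypothesis/ValiantsHypothesis` repeats the summit name (tree layout)
set_option linter.dupNamespace false

namespace Summit.ValiantsHypothesis.ValiantsHypothesis.Theorems.LiouvilleSarnakDigitalBilinearLiouville.TtStarShortShifts

open Finset

open Summit.ValiantsHypothesis.ValiantsHypothesis.Theses.LiouvilleSarnak (DigitalBilinearLiouville)
open Summit.ValiantsHypothesis.ValiantsHypothesis.Theorems.LiouvilleSarnakDigitalBilinearLiouville.TtStar
  (digitalBilinearLiouville_of_twoPointDigital)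

/-! ### §1 Gram sums of a real matrix: symmetric form and the van der Corput step -/

/-- **Four-fold symmetry of Gram sums.**  For a real matrix `a`, the Gram sum of the columns equals
the Gram sum of the rows: `Σ_{c,c'} (Σ_r a_{rc} a_{rc'})² = Σ_{r,r'} (Σ_c a_{rc} a_{r'c})²` (both are
`Σ_{r,r',c,c'} a_{rc} a_{r'c} a_{rc'} a_{r'c'}`, i.e. `‖Aᵀ A‖_F² = ‖A Aᵀ‖_F²`). [folklore] -/
theorem gramSum_symm {ι κ : Type*} [Fintype ι] [Fintype κ] (a : ι → κ → ℝ) :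
    ∑ c, ∑ c', (∑ r, a r c * a r c') ^ 2 = ∑ r, ∑ r', (∑ c, a r c * a r' c) ^ 2 := by
  have h1 : ∀ c c', (∑ r, a r c * a r c') ^ 2 = ∑ r, ∑ r', a r c * a r c' * (a r' c * a r' c') :=
    fun c c' => by rw [sq, sum_mul_sum]
  have h2 : ∀ r r', (∑ c, a r c * a r' c) ^ 2 = ∑ c, ∑ c', a r c * a r' c * (a r c' * a r' c') :=
    fun r r' => by rw [sq, sum_mul_sum]
  simp_rw [h1, h2]
  calc ∑ c, ∑ c', ∑ r, ∑ r', a r c * a r c' * (a r' c * a r' c')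
      = ∑ c, ∑ r, ∑ c', ∑ r', a r c * a r c' * (a r' c * a r' c') :=
        sum_congr rfl fun _ _ => sum_comm
    _ = ∑ r, ∑ c, ∑ c', ∑ r', a r c * a r c' * (a r' c * a r' c') := sum_comm
    _ = ∑ r, ∑ c, ∑ r', ∑ c', a r c * a r c' * (a r' c * a r' c') :=
        sum_congr rfl fun _ _ => sum_congr rfl fun _ _ => sum_comm
    _ = ∑ r, ∑ r', ∑ c, ∑ c', a r c * a r c' * (a r' c * a r' c') :=
        sum_congr rfl fun _ _ => sum_comm
    _ = ∑ r, ∑ r', ∑ c, ∑ c', a r c * a r' c * (a r c' * a r' c') :=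
        sum_congr rfl fun _ _ => sum_congr rfl fun _ _ => sum_congr rfl fun _ _ =>
          sum_congr rfl fun _ _ => by ring

/-- ★ **Van der Corput step for Gram sums.**  If the columns are indexed by `α × β` (think: `α` = low
column bits, `β` = high column bits, fibres `{(·, b)}`), then
`Σ_{p,q} (Σ_r a_{rp} a_{rq})² ≤ |β| · Σ_b Σ_{i,j} (Σ_r a_{r(i,b)} a_{r(j,b)})²`: the Gram sum over ALL
pairs of columns is at most the number of fibres times the Gram sum over pairs of columns in the SAME
fibre.  Proof: symmetric form, Cauchy–Schwarz `(Σ_b x_b)² ≤ |β| Σ_b x_b²` for each pair of rows,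
symmetric form inside each fibre. [folklore] -/
theorem gramSum_le_card_mul_fibreSum {ι α β : Type*} [Fintype ι] [Fintype α] [Fintype β]
    (a : ι → α × β → ℝ) :
    ∑ p, ∑ q, (∑ r, a r p * a r q) ^ 2 ≤
      Fintype.card β * ∑ b, ∑ i, ∑ j, (∑ r, a r (i, b) * a r (j, b)) ^ 2 := by
  rw [gramSum_symm a]
  have hsplit : ∀ r r', ∑ p, a r p * a r' p = ∑ b, ∑ i, a r (i, b) * a r' (i, b) := by
    intro r r'
    rw [Fintype.sum_prod_type, sum_comm]
  simp_rw [hsplit]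
  have hcs : ∀ r r', (∑ b, ∑ i, a r (i, b) * a r' (i, b)) ^ 2 ≤
      Fintype.card β * ∑ b, (∑ i, a r (i, b) * a r' (i, b)) ^ 2 := by
    intro r r'
    have h := sq_sum_le_card_mul_sum_sq (s := (univ : Finset β))
      (f := fun b => ∑ i, a r (i, b) * a r' (i, b))
    simpa only [Finset.card_univ] using h
  calc ∑ r, ∑ r', (∑ b, ∑ i, a r (i, b) * a r' (i, b)) ^ 2
      ≤ ∑ r, ∑ r', ((Fintype.card β : ℝ) * ∑ b, (∑ i, a r (i, b) * a r' (i, b)) ^ 2) :=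
        sum_le_sum fun r _ => sum_le_sum fun r' _ => hcs r r'
    _ = Fintype.card β * ∑ r, ∑ r', ∑ b, (∑ i, a r (i, b) * a r' (i, b)) ^ 2 := by
        simp_rw [mul_sum]
    _ = Fintype.card β * ∑ r, ∑ b, ∑ r', (∑ i, a r (i, b) * a r' (i, b)) ^ 2 := by
        congr 1
        exact sum_congr rfl fun _ _ => sum_comm
    _ = Fintype.card β * ∑ b, ∑ r, ∑ r', (∑ i, a r (i, b) * a r' (i, b)) ^ 2 := by
        congr 1
        exact sum_comm
    _ = Fintype.card β * ∑ b, ∑ i, ∑ j, (∑ r, a r (i, b) * a r (j, b)) ^ 2 := by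
        congr 1
        exact sum_congr rfl fun b _ => (gramSum_symm (fun r i => a r (i, b))).symm

/-! ### §2 The cut matrices: only short digital column shifts survive -/

/-- For integers `x_c`, `‖Σ_c (x_c : ℂ)‖² = (Σ_c x_c)²` as real numbers. [folklore] -/
theorem norm_sum_intCast_sq_eq {κ : Type*} [Fintype κ] (x : κ → ℤ) :
    ‖∑ c, ((x c : ℤ) : ℂ)‖ ^ 2 = ((∑ c, (x c : ℝ)) : ℝ) ^ 2 := by
  rw [← Int.cast_sum, Complex.norm_intCast, sq_abs]
  push_cast
  rfl

/-- `λ(m+1) · λ(m+1) = 1` (`λ` of a positive integer is `±1`). [folklore] -/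
theorem liouville_succ_mul_self (m : ℕ) :
    (ArithmeticFunction.liouville (m + 1) : ℤ) * ArithmeticFunction.liouville (m + 1) = 1 := by
  rw [ArithmeticFunction.liouville_apply (Nat.succ_ne_zero m), ← pow_two, ← pow_mul, mul_comm,
    pow_mul]
  norm_num

/-- ★ **Only short column shifts survive (quantitative, every cut).**  At level `n = k + m`, writing
the columns as `c = Fin.append i t` (low column bits `i : Fin k → Bool`, high column bits
`t : Fin m → Bool`):
`Σ_{r,r'} ‖Σ_c λ(m_{rc}) λ(m_{r'c})‖² ≤ 2^m · Σ_t Σ_{i,j} (Σ_r λ(m_{r,(i,t)}) λ(m_{r,(j,t)}))²`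
— the Gram sum of the cut matrix is controlled by the pairs of columns sharing their high bits
(`gramSum_le_card_mul_fibreSum` with `α = Fin k → Bool`, `β = Fin m → Bool`, reindexed along
`Fin.appendEquiv`). [folklore] -/
theorem twoPoint_le_shortShifts (k m : ℕ)
    (π : Fin (k + m) ⊕ Fin (k + m) ≃ Fin (2 * (k + m))) :
    (∑ r : Fin (k + m) → Bool, ∑ r' : Fin (k + m) → Bool,
      ‖∑ c : Fin (k + m) → Bool,
        ((ArithmeticFunction.liouville
            (Nat.ofBits (fun j : Fin (2 * (k + m)) => Sum.elim r c (π.symm j)) + 1) : ℤ) : ℂ) *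
        ((ArithmeticFunction.liouville
            (Nat.ofBits (fun j : Fin (2 * (k + m)) => Sum.elim r' c (π.symm j)) + 1) : ℤ) : ℂ)‖ ^ 2) ≤
    2 ^ m * ∑ t : Fin m → Bool, ∑ i : Fin k → Bool, ∑ j : Fin k → Bool,
      (∑ r : Fin (k + m) → Bool,
        ((ArithmeticFunction.liouville
            (Nat.ofBits (fun l : Fin (2 * (k + m)) => Sum.elim r (Fin.append i t) (π.symm l)) + 1) *
          ArithmeticFunction.liouville
            (Nat.ofBits (fun l : Fin (2 * (k + m)) => Sum.elim r (Fin.append j t) (π.symm l)) + 1) :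
          ℤ) : ℝ)) ^ 2 := by
  -- the real matrix `a r c = λ(m_{rc})`
  set a : (Fin (k + m) → Bool) → (Fin (k + m) → Bool) → ℝ := fun r c =>
    ((ArithmeticFunction.liouville
      (Nat.ofBits (fun j : Fin (2 * (k + m)) => Sum.elim r c (π.symm j)) + 1) : ℤ) : ℝ) with ha
  -- Step 1: complex norms are real squares, `S = Σ_{r,r'} (Σ_c a_{rc} a_{r'c})²`
  have hS : (∑ r : Fin (k + m) → Bool, ∑ r' : Fin (k + m) → Bool,
      ‖∑ c : Fin (k + m) → Bool,
        ((ArithmeticFunction.liouville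
            (Nat.ofBits (fun j : Fin (2 * (k + m)) => Sum.elim r c (π.symm j)) + 1) : ℤ) : ℂ) *
        ((ArithmeticFunction.liouville
            (Nat.ofBits (fun j : Fin (2 * (k + m)) => Sum.elim r' c (π.symm j)) + 1) : ℤ) : ℂ)‖ ^ 2) =
      ∑ r, ∑ r', (∑ c, a r c * a r' c) ^ 2 := by
    refine sum_congr rfl fun r _ => sum_congr rfl fun r' _ => ?_
    have h := norm_sum_intCast_sq_eq (fun c : Fin (k + m) → Bool =>
      ArithmeticFunction.liouville
          (Nat.ofBits (fun j : Fin (2 * (k + m)) => Sum.elim r c (π.symm j)) + 1) *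
        ArithmeticFunction.liouville
          (Nat.ofBits (fun j : Fin (2 * (k + m)) => Sum.elim r' c (π.symm j)) + 1))
    simp only [Int.cast_mul] at h
    rw [h]
  rw [hS, ← gramSum_symm a]
  -- Step 2: reindex the columns along `Fin.appendEquiv k m : (low, high) ≃ columns`
  have hre : ∑ c, ∑ c', (∑ r, a r c * a r c') ^ 2 =
      ∑ p : (Fin k → Bool) × (Fin m → Bool), ∑ q : (Fin k → Bool) × (Fin m → Bool),
        (∑ r, a r (Fin.appendEquiv k m p) * a r (Fin.appendEquiv k m q)) ^ 2 := by
    rw [← (Fin.appendEquiv k m).sum_comp]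
    exact sum_congr rfl fun p _ => by rw [← (Fin.appendEquiv k m).sum_comp]
  rw [hre]
  -- Step 3: the van der Corput step with fibres = fixed high bits
  have hv := gramSum_le_card_mul_fibreSum (fun r (p : (Fin k → Bool) × (Fin m → Bool)) =>
    a r (Fin.appendEquiv k m p))
  have hcard : (Fintype.card (Fin m → Bool) : ℝ) = 2 ^ m := by
    simp [Fintype.card_bool, Fintype.card_fin]
  rw [hcard] at hv
  refine hv.trans (le_of_eq ?_)
  congr 1
  refine sum_congr rfl fun t _ => sum_congr rfl fun i _ => sum_congr rfl fun j _ => ?_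
  simp only [ha, Int.cast_mul]
  rfl

/-- ★ **Diagonal evaluated.**  At level `n = k + m`, for every cut `π`:
`Σ_{r,r'} ‖Σ_c λ(m_{rc}) λ(m_{r'c})‖² ≤ 16^{k+m} / 2^k + 2^m · Σ_t Σ_i Σ_{j ≠ i} (Σ_r λ(m_{r,(i,t)}) λ(m_{r,(j,t)}))²`
— the pairs `i = j` of `twoPoint_le_shortShifts` contribute exactly `2^m · 2^m · 2^k · 4^{k+m} =
16^{k+m}/2^k` (`λ² = 1`), so a `(1/2^k)`-fraction of the trivial bound plus the short-shift terms.
[folklore] -/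
theorem twoPoint_le_diag_add_shortShifts (k m : ℕ)
    (π : Fin (k + m) ⊕ Fin (k + m) ≃ Fin (2 * (k + m))) :
    (∑ r : Fin (k + m) → Bool, ∑ r' : Fin (k + m) → Bool,
      ‖∑ c : Fin (k + m) → Bool,
        ((ArithmeticFunction.liouville
            (Nat.ofBits (fun j : Fin (2 * (k + m)) => Sum.elim r c (π.symm j)) + 1) : ℤ) : ℂ) *
        ((ArithmeticFunction.liouville
            (Nat.ofBits (fun j : Fin (2 * (k + m)) => Sum.elim r' c (π.symm j)) + 1) : ℤ) : ℂ)‖ ^ 2) ≤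
    16 ^ (k + m) / 2 ^ k + 2 ^ m * ∑ t : Fin m → Bool, ∑ i : Fin k → Bool,
      ∑ j ∈ univ.erase i,
      (∑ r : Fin (k + m) → Bool,
        ((ArithmeticFunction.liouville
            (Nat.ofBits (fun l : Fin (2 * (k + m)) => Sum.elim r (Fin.append i t) (π.symm l)) + 1) *
          ArithmeticFunction.liouville
            (Nat.ofBits (fun l : Fin (2 * (k + m)) => Sum.elim r (Fin.append j t) (π.symm l)) + 1) :
          ℤ) : ℝ)) ^ 2 := by
  refine (twoPoint_le_shortShifts k m π).trans ?_
  -- name the short-shift terms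
  set T : (Fin m → Bool) → (Fin k → Bool) → (Fin k → Bool) → ℝ := fun t i j =>
    (∑ r : Fin (k + m) → Bool,
        ((ArithmeticFunction.liouville
            (Nat.ofBits (fun l : Fin (2 * (k + m)) => Sum.elim r (Fin.append i t) (π.symm l)) + 1) *
          ArithmeticFunction.liouville
            (Nat.ofBits (fun l : Fin (2 * (k + m)) => Sum.elim r (Fin.append j t) (π.symm l)) + 1) :
          ℤ) : ℝ)) ^ 2 with hT
  -- the diagonal terms: `T t i i = 4^{k+m}`
  have hdiag : ∀ t i, T t i i = 4 ^ (k + m) := by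
    intro t i
    simp only [hT, liouville_succ_mul_self, Int.cast_one, sum_const, Finset.card_univ,
      Fintype.card_fun, Fintype.card_bool, Fintype.card_fin, nsmul_eq_mul, mul_one]
    push_cast
    rw [← pow_mul, show (4 : ℝ) = 2 ^ 2 by norm_num, ← pow_mul, mul_comm]
  -- split off the diagonal in each `Σ_j`
  have hsplit : ∀ t i, ∑ j, T t i j = T t i i + ∑ j ∈ univ.erase i, T t i j := by
    intro t i
    rw [← Finset.add_sum_erase _ _ (mem_univ i)]
  change 2 ^ m * ∑ t, ∑ i, ∑ j, T t i j ≤ 16 ^ (k + m) / 2 ^ k + 2 ^ m * ∑ t, ∑ i, ∑ j ∈ univ.erase i, T t i j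
  simp_rw [hsplit, sum_add_distrib, hdiag, mul_add]
  simp only [sum_const, Finset.card_univ, Fintype.card_fun, Fintype.card_bool, Fintype.card_fin,
    nsmul_eq_mul]
  push_cast
  have h16 : (2 : ℝ) ^ m * (2 ^ m * (2 ^ k * 4 ^ (k + m))) = 16 ^ (k + m) / 2 ^ k := by
    rw [eq_div_iff (by positivity), show (16 : ℝ) = 2 ^ 4 by norm_num,
      show (4 : ℝ) = 2 ^ 2 by norm_num]
    simp only [← pow_mul, ← pow_add]
    congr 1
    ring
  rw [h16]

/-! ### §3 The stub and the crux from the fixed-short-shift statements `SDS(k)` -/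

/-- ★ **`stub_twoPointDigital` from short digital shifts.**  Suppose `SDS(k)` for every `k`: for every
`ε > 0` and all large `m`, for every cut `π` at level `k + m` and every pair of distinct low column
patterns `i ≠ j : Fin k → Bool`,
`Σ_{t : Fin m → Bool} (Σ_r λ(m_{r,(i,t)}) λ(m_{r,(j,t)}))² ≤ ε 8^{k+m}`
(mean square, over the high column bits `t`, of the two-point correlation of `λ` along the row family
with the FIXED column shift `i → j`; trivial bound `8^{k+m}/2^k`).  Then the open stub
`stub_twoPointDigital` of line `tt_star` holds verbatim.  Proof: `twoPoint_le_diag_add_shortShifts`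
with `2^k ≥ 2/ε` and `SDS(k)` at `ε / 2^{k+1}` for the `< 4^k` off-diagonal pairs. [folklore] -/
theorem twoPointDigital_of_shortShifts
    (hSDS : ∀ k : ℕ, ∀ ε : ℝ, 0 < ε → ∃ m₀ : ℕ, ∀ m ≥ m₀,
      ∀ π : Fin (k + m) ⊕ Fin (k + m) ≃ Fin (2 * (k + m)), ∀ i j : Fin k → Bool, i ≠ j →
        ∑ t : Fin m → Bool,
          (∑ r : Fin (k + m) → Bool,
            ((ArithmeticFunction.liouville
                (Nat.ofBits (fun l : Fin (2 * (k + m)) => Sum.elim r (Fin.append i t) (π.symm l)) +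
                  1) *
              ArithmeticFunction.liouville
                (Nat.ofBits (fun l : Fin (2 * (k + m)) => Sum.elim r (Fin.append j t) (π.symm l)) +
                  1) : ℤ) : ℝ)) ^ 2 ≤ ε * 8 ^ (k + m)) :
    ∀ ε : ℝ, 0 < ε → ∃ n₀ : ℕ, ∀ n ≥ n₀, ∀ π : Fin n ⊕ Fin n ≃ Fin (2 * n),
      (∑ r : Fin n → Bool, ∑ r' : Fin n → Bool,
        ‖∑ c : Fin n → Bool,
          ((ArithmeticFunction.liouville
              (Nat.ofBits (fun j : Fin (2 * n) => Sum.elim r c (π.symm j)) + 1) : ℤ) : ℂ) *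
          ((ArithmeticFunction.liouville
              (Nat.ofBits (fun j : Fin (2 * n) => Sum.elim r' c (π.symm j)) + 1) : ℤ) : ℂ)‖ ^ 2) ≤
      ε * 16 ^ n := by
  intro ε hε
  -- choose `k` with `2 / ε ≤ 2^k`
  obtain ⟨k, hk⟩ := exists_nat_gt (2 / ε)
  have hk2 : 2 / ε ≤ (2 : ℝ) ^ k :=
    hk.le.trans (by exact_mod_cast (Nat.lt_two_pow_self (n := k)).le)
  -- `SDS(k)` at `ε' = ε / 2^(k+1)`
  obtain ⟨m₀, hm₀⟩ := hSDS k (ε / 2 ^ (k + 1)) (by positivity)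
  refine ⟨k + m₀, fun n hn π => ?_⟩
  obtain ⟨m, rfl⟩ := Nat.exists_eq_add_of_le (show k ≤ n by omega)
  have hm : m₀ ≤ m := by omega
  refine (twoPoint_le_diag_add_shortShifts k m π).trans ?_
  -- the diagonal part: `16^(k+m) / 2^k ≤ (ε/2) 16^(k+m)`
  have hdiag : (16 : ℝ) ^ (k + m) / 2 ^ k ≤ ε / 2 * 16 ^ (k + m) := by
    rw [div_le_iff₀ (by positivity)]
    have h1 : (1 : ℝ) ≤ ε / 2 * 2 ^ k := by
      have := (div_le_iff₀ hε).mp hk2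
      linarith
    nlinarith [show (0 : ℝ) < 16 ^ (k + m) by positivity]
  -- the off-diagonal part
  have hoff : (2 : ℝ) ^ m * ∑ t : Fin m → Bool, ∑ i : Fin k → Bool, ∑ j ∈ univ.erase i,
      (∑ r : Fin (k + m) → Bool,
        ((ArithmeticFunction.liouville
            (Nat.ofBits (fun l : Fin (2 * (k + m)) => Sum.elim r (Fin.append i t) (π.symm l)) + 1) *
          ArithmeticFunction.liouville
            (Nat.ofBits (fun l : Fin (2 * (k + m)) => Sum.elim r (Fin.append j t) (π.symm l)) + 1) :
          ℤ) : ℝ)) ^ 2 ≤ ε / 2 * 16 ^ (k + m) := by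
    -- swap `Σ_t` inside and bound each `(i, j)`, `j ≠ i`, by `SDS(k)`
    rw [sum_comm]
    have hij : ∀ i : Fin k → Bool, ∑ t : Fin m → Bool, ∑ j ∈ univ.erase i,
        (∑ r : Fin (k + m) → Bool,
          ((ArithmeticFunction.liouville
              (Nat.ofBits (fun l : Fin (2 * (k + m)) => Sum.elim r (Fin.append i t) (π.symm l)) + 1) *
            ArithmeticFunction.liouville
              (Nat.ofBits (fun l : Fin (2 * (k + m)) => Sum.elim r (Fin.append j t) (π.symm l)) + 1) :
            ℤ) : ℝ)) ^ 2 ≤ 2 ^ k * (ε / 2 ^ (k + 1) * 8 ^ (k + m)) := by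
      intro i
      rw [sum_comm]
      calc ∑ j ∈ univ.erase i, ∑ t : Fin m → Bool,
            (∑ r : Fin (k + m) → Bool,
              ((ArithmeticFunction.liouville
                  (Nat.ofBits (fun l : Fin (2 * (k + m)) => Sum.elim r (Fin.append i t) (π.symm l)) +
                    1) *
                ArithmeticFunction.liouville
                  (Nat.ofBits (fun l : Fin (2 * (k + m)) => Sum.elim r (Fin.append j t) (π.symm l)) +
                    1) : ℤ) : ℝ)) ^ 2
          ≤ ∑ j ∈ univ.erase i, ε / 2 ^ (k + 1) * 8 ^ (k + m) :=
            sum_le_sum fun j hj => hm₀ m hm π i j (ne_of_mem_erase hj).symm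
        _ ≤ ∑ _j : Fin k → Bool, ε / 2 ^ (k + 1) * 8 ^ (k + m) :=
            sum_le_sum_of_subset_of_nonneg (erase_subset _ _) fun _ _ _ => by positivity
        _ = 2 ^ k * (ε / 2 ^ (k + 1) * 8 ^ (k + m)) := by
            simp [sum_const, Finset.card_univ, Fintype.card_bool, Fintype.card_fin]
    calc (2 : ℝ) ^ m * ∑ i : Fin k → Bool, ∑ t : Fin m → Bool, ∑ j ∈ univ.erase i,
          (∑ r : Fin (k + m) → Bool,
            ((ArithmeticFunction.liouville
                (Nat.ofBits (fun l : Fin (2 * (k + m)) => Sum.elim r (Fin.append i t) (π.symm l)) +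
                  1) *
              ArithmeticFunction.liouville
                (Nat.ofBits (fun l : Fin (2 * (k + m)) => Sum.elim r (Fin.append j t) (π.symm l)) +
                  1) : ℤ) : ℝ)) ^ 2
        ≤ 2 ^ m * ∑ _i : Fin k → Bool, 2 ^ k * (ε / 2 ^ (k + 1) * 8 ^ (k + m)) := by
          gcongr with i
          exact hij i
      _ = ε / 2 * 16 ^ (k + m) := by
          simp only [sum_const, Finset.card_univ, Fintype.card_fun, Fintype.card_bool,
            Fintype.card_fin, nsmul_eq_mul]
          push_cast
          rw [show (16 : ℝ) = 2 ^ 4 by norm_num, show (8 : ℝ) = 2 ^ 3 by norm_num]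
          simp only [← pow_mul]
          field_simp
          ring
  calc (16 : ℝ) ^ (k + m) / 2 ^ k + _ ≤ ε / 2 * 16 ^ (k + m) + ε / 2 * 16 ^ (k + m) :=
        add_le_add hdiag hoff
    _ = ε * 16 ^ (k + m) := by ring

/-- ★ **The crux from short digital shifts.**  The family `SDS(k)` (`k ≥ 1`; see
`twoPointDigital_of_shortShifts`) implies `DigitalBilinearLiouville` (stmt-ValiantsHypothesis-14774)
BY NAME, through the landed transfer `…TtStar.digitalBilinearLiouville_of_twoPointDigital`
(`stub_fourthMoment`, proved, + composition of line `tt_star`). [folklore] -/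
theorem digitalBilinearLiouville_of_shortShifts
    (hSDS : ∀ k : ℕ, ∀ ε : ℝ, 0 < ε → ∃ m₀ : ℕ, ∀ m ≥ m₀,
      ∀ π : Fin (k + m) ⊕ Fin (k + m) ≃ Fin (2 * (k + m)), ∀ i j : Fin k → Bool, i ≠ j →
        ∑ t : Fin m → Bool,
          (∑ r : Fin (k + m) → Bool,
            ((ArithmeticFunction.liouville
                (Nat.ofBits (fun l : Fin (2 * (k + m)) => Sum.elim r (Fin.append i t) (π.symm l)) +
                  1) *
              ArithmeticFunction.liouville
                (Nat.ofBits (fun l : Fin (2 * (k + m)) => Sum.elim r (Fin.append j t) (π.symm l)) +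
                  1) : ℤ) : ℝ)) ^ 2 ≤ ε * 8 ^ (k + m)) :
    DigitalBilinearLiouville :=
  digitalBilinearLiouville_of_twoPointDigital (twoPointDigital_of_shortShifts hSDS)

end Summit.ValiantsHypothesis.ValiantsHypothesis.Theorems.LiouvilleSarnakDigitalBilinearLiouville.TtStarShortShifts
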